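import Literature.NumberTheory.LFunctions.TuranLiouvilleCriterion
import HarnessLib

/-!
# Turán's Liouville criterion, sharp form: `T(n) ≥ −K(1 + log n)²/√n` for large `n` implies the Riemann hypothesis

Topic: `Literature/NumberTheory/LFunctions` (sub-namespace `TuranLiouville`, extending
`TuranLiouvilleCriterion.lean`). Everything in this file is PROVED (sorry-free).

With `λ` Liouville's function and `T(x) = ∑_{n ≤ x} λ(n)/n` (the tree's
`Literature.NumberTheory.LFunctions.liouvilleHarmonicSum`; Turán's `W_n(1)`), the companion file
proves: `T(n) ≥ 0` for all large `n` implies RH (Turán 1948, Thm. I, through (14.38.1)). Turán's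
*sharp* criterion (Thm. II / IV of the 1948 paper, as reported in Ingham's review, MR 10,286: "If,
for `n > n₀`, `U_n(s)` omits in `σ > 1 + K n^{ϑ−1}` a real value `c_n` with
`−K₁ n^{ϑ−1} ≤ c_n ≤ K₁ n^{ϑ−1}`, then `ζ(s) ≠ 0` for `σ > ϑ`", case `ϑ = 1/2`, `c_n = 0`; quoted by
Beliakov–Matiyasevich 2014 §1 and Montgomery 1983 §1) only yields `W_n(σ_n) ≥ 0` at
`σ_n = 1 + K/√n`, i.e. `T(n) = W_n(1) ≥ −(K/√n) ∑_{m ≤ n} log m/m ≥ −K(1 + log n)²/√n`. The Landau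
step with this weaker input is the content of this file:

* `TuranLiouville.integrableOn_liouvilleHarmonicSum_rpow_of_lower_bound` — **Landau's theorem
  applied to `T` with a compensator**: if `T(n) ≥ −K(1 + log n)²/√n` for all `n ≥ N₁`, then
  `∫_1^∞ |T(x)| x^{-(σ+1)} dx < ∞` for every `σ > −1/2`. The function
  `g(x) = T(x) + 2K x^{-1/2}(1 + log x)²` is `≥ 0` for `x > N₁ + 1`, and its transform is
  `ζ(2u+2)/ζ₁(u+1) + 2K·H(u)` with `H(u) = ∫_1^∞ x^{-1/2}(1+log x)² x^{-(u+1)} dx` holomorphic on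
  `Re u > −1/2` (`differentiableOn_mellinIoi_compensator`); Landau's lemma
  (`Landau.integrableOn_of_differentiableOn_union_convex`, MV Lemma 15.1) applies on the same window
  as in the companion file (`exists_strip_riemannZeta₁_ne_zero`, `differentiableAt_continuation`).
* `TuranLiouville.mellinIoi_mul_riemannZeta₁_eq_of_integrable`,
  `TuranLiouville.riemannZeta_ne_zero_of_integrable`: continuation of
  `(∫_1^∞ T x^{-(u+1)}) · ζ₁(u+1) = ζ(2u+2)` to `Re u > −1/2` (identity theorem on the convex
  half-plane) and `ζ ≠ 0` on `1/2 < Re s < 1`.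
* `riemannHypothesis_of_liouvilleHarmonicSum_lower_bound`: **if `T(n) ≥ −K(1 + log n)²/√n` for all
  `n ≥ N₁`, then `RiemannHypothesis`** (via `quasiRiemannHypothesis_one_half_iff_holds`). In
  particular Mossinghoff–Trudgian's rendering "if there exists a positive constant `c` such that
  `T(n) > −c/√n` for all sufficiently large `n`, then the Riemann hypothesis would follow" (2012, §1).

## References

* [Turan1948] P. Turán, *On some approximative Dirichlet-polynomials in the theory of the
  zeta-function of Riemann*, Danske Vid. Selsk. Mat.-Fys. Medd. 24 (1948) no. 17, Thms. I, II, IV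
  (read through A. E. Ingham's review, MR 10,286 = *Reviews in Number Theory 1940–72*, M30-10, and
  Montgomery 1983 §1).
* [MossinghoffTrudgian2012] M. J. Mossinghoff, T. S. Trudgian, *Between the problems of Pólya and
  Turán*, J. Aust. Math. Soc. 93 (2012), §1.
* [Titchmarsh1986] E. C. Titchmarsh, *The Theory of the Riemann Zeta-Function*, 2nd ed., §14.32,
  §14.38.
* [MontgomeryVaughan2007] H. L. Montgomery, R. C. Vaughan, *Multiplicative Number Theory I*, §15.1
  Lemma 15.1 (Landau's lemma for Mellin transforms; the tree's `LandauOscillation.lean`).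

## Design notes

No new definitions. The compensator is written out as `fun x ↦ x ^ (-(1/2 : ℝ)) * (1 + log x)^2`; any
non-negative `k` with `T + k ≥ 0` eventually and `∫_1^∞ k x^{-(σ+1)} dx < ∞` for all `σ > −1/2` would
do. The abscissa `σ₁ = 3/2` (rather than `2`) keeps the window `(−1/2, σ₁ + 1]` inside the strip of
`exists_strip_riemannZeta₁_ne_zero` after the shift `u ↦ u + 1`.
-/

noncomputable section

open Complex Filter Set MeasureTheory ArithmeticFunction Metric Topology

namespace Literature.NumberTheory.LFunctions

namespace TuranLiouville

/-! ### The compensator `x^{-1/2} (1 + log x)²` -/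

/-- `(1 + log x)² ≤ (1 + 2/δ)² x^δ` for `x ≥ 1`, `δ > 0` (from `log x ≤ x^ε/ε`, `ε = δ/2`).
[folklore] -/
theorem one_add_log_sq_le {x δ : ℝ} (hx : 1 ≤ x) (hδ : 0 < δ) :
    (1 + Real.log x) ^ 2 ≤ (1 + 2 / δ) ^ 2 * x ^ δ := by
  have hx0 : 0 ≤ x := zero_le_one.trans hx
  have h1 : Real.log x ≤ x ^ (δ / 2) / (δ / 2) := Real.log_le_rpow_div hx0 (by positivity)
  have h2 : 1 ≤ x ^ (δ / 2) := Real.one_le_rpow hx (by positivity)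
  have h3 : 1 + Real.log x ≤ (1 + 2 / δ) * x ^ (δ / 2) := by
    rw [add_mul, one_mul]
    have : x ^ (δ / 2) / (δ / 2) = 2 / δ * x ^ (δ / 2) := by field_simp
    linarith
  have h4 : 0 ≤ 1 + Real.log x := by linarith [Real.log_nonneg hx]
  calc (1 + Real.log x) ^ 2 ≤ ((1 + 2 / δ) * x ^ (δ / 2)) ^ 2 := pow_le_pow_left₀ h4 h3 2
    _ = (1 + 2 / δ) ^ 2 * x ^ δ := by
        rw [mul_pow, ← Real.rpow_natCast (x ^ (δ / 2)) 2, ← Real.rpow_mul hx0]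
        norm_num

/-- The compensator is measurable. [folklore] -/
theorem measurable_compensator :
    Measurable fun x : ℝ ↦ x ^ (-(1 / 2 : ℝ)) * (1 + Real.log x) ^ 2 :=
  (measurable_id.pow_const _).mul ((measurable_const.add Real.measurable_log).pow_const _)

/-- `∫_1^∞ x^{-1/2}(1 + log x)² x^{-(σ+1)} dx < ∞` for every `σ > −1/2`. [folklore] -/
theorem integrableOn_compensator {σ : ℝ} (hσ : -1 / 2 < σ) :
    IntegrableOn (fun x : ℝ ↦ x ^ (-(1 / 2 : ℝ)) * (1 + Real.log x) ^ 2 * x ^ (-(σ + 1)))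
      (Ioi 1) := by
  set δ : ℝ := (σ + 1 / 2) / 2 with hδ
  have hδ0 : 0 < δ := by rw [hδ]; linarith
  have hdom : IntegrableOn (fun x : ℝ ↦ (1 + 2 / δ) ^ 2 * x ^ (-1 - δ)) (Ioi 1) :=
    ((integrableOn_Ioi_rpow_of_lt (by linarith) zero_lt_one).const_mul _)
  refine Integrable.mono' hdom ?_ ?_
  · exact ((measurable_compensator.mul (measurable_id.pow_const _))).aestronglyMeasurable
  · rw [ae_restrict_iff' measurableSet_Ioi]
    refine Eventually.of_forall fun x (hx : 1 < x) ↦ ?_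
    have hx0 : 0 < x := zero_lt_one.trans hx
    have hpos1 : 0 < x ^ (-(1 / 2 : ℝ)) := Real.rpow_pos_of_pos hx0 _
    have hpos2 : 0 < x ^ (-(σ + 1)) := Real.rpow_pos_of_pos hx0 _
    rw [norm_mul, norm_mul, Real.norm_eq_abs, Real.norm_eq_abs, Real.norm_eq_abs,
      abs_of_pos hpos1, abs_of_pos hpos2, abs_of_nonneg (sq_nonneg _)]
    have hlog := one_add_log_sq_le hx.le hδ0
    calc x ^ (-(1 / 2 : ℝ)) * (1 + Real.log x) ^ 2 * x ^ (-(σ + 1))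
        ≤ x ^ (-(1 / 2 : ℝ)) * ((1 + 2 / δ) ^ 2 * x ^ δ) * x ^ (-(σ + 1)) := by gcongr
      _ = (1 + 2 / δ) ^ 2 * x ^ (-1 - δ) := by
        have : -(1 / 2 : ℝ) + δ + -(σ + 1) = -1 - δ := by rw [hδ]; ring
        rw [← this, Real.rpow_add hx0, Real.rpow_add hx0]
        ring

/-- The transform `H(u) = ∫_1^∞ x^{-1/2}(1 + log x)² x^{-(u+1)} dx` is holomorphic on `Re u > −1/2`.
[cite: MontgomeryVaughan2007, §15.1 Lemma 15.1] -/
theorem differentiableOn_mellinIoi_compensator :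
    DifferentiableOn ℂ (Landau.mellinIoi fun x : ℝ ↦ x ^ (-(1 / 2 : ℝ)) * (1 + Real.log x) ^ 2)
      {s : ℂ | -1 / 2 < s.re} :=
  Landau.differentiableOn_mellinIoi_of_forall measurable_compensator
    fun _ hσ ↦ integrableOn_compensator hσ

/-- Integrability of a complex Mellin integrand `g(x) x^{-(u+1)}` on `(1,∞)` from real absolute
convergence at some `σ₁ < Re u`. [folklore] -/
theorem integrable_ofReal_mul_cpow {g : ℝ → ℝ} (hg : Measurable g) {σ₁ : ℝ}
    (hint : IntegrableOn (fun x ↦ g x * x ^ (-(σ₁ + 1))) (Ioi 1)) {u : ℂ} (hu : σ₁ < u.re) :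
    Integrable (fun x : ℝ ↦ (g x : ℂ) * (x : ℂ) ^ (-(u + 1))) (volume.restrict (Ioi 1)) := by
  have := Landau.integrable_mellinIntegrand hg hint 0 hu
  refine this.congr (Eventually.of_forall fun x ↦ ?_)
  simp [Landau.mellinIntegrand]

/-- `T(x) = T(⌊x⌋)`. [folklore] -/
theorem liouvilleHarmonicSum_eq_floor (x : ℝ) :
    liouvilleHarmonicSum x = liouvilleHarmonicSum (⌊x⌋₊ : ℕ) := by
  simp [liouvilleHarmonicSum, Nat.floor_natCast]

/-! ### Landau's theorem applied to `T` with the compensator -/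

/-- **Landau's theorem applied to `T` with a compensator** (Turán 1948, proof of Thms. I–II in
Ingham's rendering; hypothesis in the `O(n^{-1/2})`-form of Mossinghoff–Trudgian 2012 §1 weakened by
`(1 + log n)²`): if `T(n) ≥ −K(1 + log n)²/√n` for all `n ≥ N₁`, then
`∫_1^∞ |T(x)| x^{-(σ+1)} dx < ∞` for every `σ > −1/2`.
[cite: Turan1948, Thms. I–II] [cite: MontgomeryVaughan2007, §15.1 Lemma 15.1] -/
theorem integrableOn_liouvilleHarmonicSum_rpow_of_lower_bound {K : ℝ} {N₁ : ℕ}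
    (hb : ∀ n : ℕ, N₁ ≤ n → -(K * (1 + Real.log n) ^ 2 / Real.sqrt n) ≤ liouvilleHarmonicSum n)
    {σ : ℝ} (hσ : -1 / 2 < σ) :
    IntegrableOn (fun x ↦ liouvilleHarmonicSum x * x ^ (-(σ + 1))) (Ioi 1) := by
  -- WLOG `K ≥ 0`
  set K' : ℝ := max K 0 with hK'
  have hK'0 : 0 ≤ K' := le_max_right _ _
  have hb' : ∀ n : ℕ, N₁ ≤ n →
      -(K' * (1 + Real.log n) ^ 2 / Real.sqrt n) ≤ liouvilleHarmonicSum n := by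
    intro n hn
    refine le_trans ?_ (hb n hn)
    have h0 : 0 ≤ (1 + Real.log n) ^ 2 / Real.sqrt n := by positivity
    have : K * (1 + Real.log n) ^ 2 / Real.sqrt n ≤ K' * (1 + Real.log n) ^ 2 / Real.sqrt n := by
      rw [mul_div_assoc, mul_div_assoc]
      exact mul_le_mul_of_nonneg_right (le_max_left _ _) h0
    linarith
  -- the compensated, eventually non-negative function
  set k : ℝ → ℝ := fun x ↦ x ^ (-(1 / 2 : ℝ)) * (1 + Real.log x) ^ 2 with hk
  set g : ℝ → ℝ := fun x ↦ liouvilleHarmonicSum x + 2 * K' * k x with hg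
  have hgm : Measurable g :=
    measurable_liouvilleHarmonicSum.add (measurable_const.mul measurable_compensator)
  have hX₁ : (1 : ℝ) ≤ (N₁ : ℝ) + 1 := by
    have : (0 : ℝ) ≤ N₁ := Nat.cast_nonneg _
    linarith
  have hpos : ∀ x : ℝ, (N₁ : ℝ) + 1 < x → 0 ≤ g x := by
    intro x hx
    have hx1 : 1 ≤ x := hX₁.trans hx.le
    have hx0 : 0 < x := by linarith
    set n : ℕ := ⌊x⌋₊ with hn
    have hnN : N₁ + 1 ≤ n := Nat.le_floor (by push_cast; exact hx.le)
    have hn1 : 1 ≤ n := le_trans (by omega) hnN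
    have hn1R : (1 : ℝ) ≤ n := by exact_mod_cast hn1
    have hn0R : (0 : ℝ) < n := by linarith
    have hnx : (n : ℝ) ≤ x := Nat.floor_le hx0.le
    have hxn : x ≤ 2 * n := by
      have := Nat.lt_floor_add_one x
      rw [← hn] at this
      linarith
    have hT : -(K' * (1 + Real.log n) ^ 2 / Real.sqrt n) ≤ liouvilleHarmonicSum x := by
      rw [liouvilleHarmonicSum_eq_floor x]
      exact hb' n (le_trans (Nat.le_succ _) hnN)
    -- `K'(1 + log n)²/√n ≤ 2K' x^{-1/2} (1 + log x)²`
    have hlog : (1 + Real.log n) ^ 2 ≤ (1 + Real.log x) ^ 2 := by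
      have h0 : 0 ≤ 1 + Real.log n := by linarith [Real.log_nonneg hn1R]
      exact pow_le_pow_left₀ h0 (by linarith [Real.log_le_log hn0R hnx]) 2
    have hsqrt : 1 / Real.sqrt n ≤ 2 * x ^ (-(1 / 2 : ℝ)) := by
      rw [Real.rpow_neg hx0.le, ← Real.sqrt_eq_rpow, ← div_eq_mul_inv,
        div_le_div_iff₀ (Real.sqrt_pos.2 hn0R) (Real.sqrt_pos.2 hx0), one_mul]
      have h4 : Real.sqrt x ≤ Real.sqrt (4 * n) := Real.sqrt_le_sqrt (by linarith)
      rw [Real.sqrt_mul (by norm_num), show Real.sqrt 4 = 2 by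
        rw [show (4 : ℝ) = 2 ^ 2 by norm_num, Real.sqrt_sq (by norm_num)]] at h4
      exact h4
    have hkey : K' * (1 + Real.log n) ^ 2 / Real.sqrt n ≤ 2 * K' * k x := by
      rw [hk]
      calc K' * (1 + Real.log n) ^ 2 / Real.sqrt n
          = K' * ((1 + Real.log n) ^ 2 * (1 / Real.sqrt n)) := by ring
        _ ≤ K' * ((1 + Real.log x) ^ 2 * (2 * x ^ (-(1 / 2 : ℝ)))) := by
          refine mul_le_mul_of_nonneg_left ?_ hK'0
          exact mul_le_mul hlog hsqrt (by positivity) (sq_nonneg _)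
        _ = 2 * K' * (x ^ (-(1 / 2 : ℝ)) * (1 + Real.log x) ^ 2) := by ring
    rw [hg]
    simp only
    linarith
  -- absolute convergence at `σ₁ = 3/2`
  have hTint : IntegrableOn (fun x : ℝ ↦ liouvilleHarmonicSum x * x ^ (-((3 / 2 : ℝ) + 1)))
      (Ioi 1) := integrableOn_liouvilleHarmonicSum_mul_rpow (by norm_num)
  have hint : IntegrableOn (fun x ↦ g x * x ^ (-((3 / 2 : ℝ) + 1))) (Ioi 1) := by
    have hk' := (integrableOn_compensator (σ := 3 / 2) (by norm_num)).const_mul (2 * K')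
    have := hTint.add hk'
    refine this.congr_fun (fun x _ ↦ ?_) measurableSet_Ioi
    simp only [hg, hk, Pi.add_apply]
    ring
  -- the window about the real segment `(-1/2, 5/2]`
  obtain ⟨δ, hδ, hfree⟩ := exists_strip_riemannZeta₁_ne_zero
  set W₀ : Set ℂ := {s : ℂ | -1 / 2 < s.re ∧ s.re < 4 ∧ -δ < s.im ∧ s.im < δ} with hW₀
  have hW₀o : IsOpen W₀ :=
    (isOpen_lt continuous_const Complex.continuous_re).inter
      ((isOpen_lt Complex.continuous_re continuous_const).inter
      ((isOpen_lt continuous_const Complex.continuous_im).inter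
      (isOpen_lt Complex.continuous_im continuous_const)))
  have hW₀c : Convex ℝ W₀ := by
    have : W₀ = {s : ℂ | -1 / 2 < s.re} ∩ ({s : ℂ | s.re < 4} ∩ ({s : ℂ | -δ < s.im} ∩
        {s : ℂ | s.im < δ})) := by
      ext s; simp [hW₀]
    rw [this]
    exact (convex_halfSpace_re_gt _).inter ((convex_halfSpace_re_lt _).inter
      ((convex_halfSpace_im_gt _).inter (convex_halfSpace_im_lt _)))
  have hW₀r : ∀ σ' : ℝ, -1 / 2 < σ' → σ' ≤ 3 / 2 + 1 → (σ' : ℂ) ∈ W₀ := by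
    intro σ' h1 h2
    simp only [hW₀, Set.mem_setOf_eq, Complex.ofReal_re, Complex.ofReal_im]
    exact ⟨h1, by linarith, by linarith, hδ⟩
  -- the continuation `Φ(u) = ζ(2u+2)/ζ₁(u+1) + 2K' H(u)`
  set H : ℂ → ℂ := Landau.mellinIoi k with hH
  set Φ : ℂ → ℂ := fun u ↦ riemannZeta (2 * u + 2) / riemannZeta₁ (u + 1) + 2 * K' * H u with hΦ
  have hmem : ∀ u ∈ ({s : ℂ | 3 / 2 < s.re} ∪ W₀), -1 / 2 < u.re ∧ riemannZeta₁ (u + 1) ≠ 0 := by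
    rintro u (hu | hu)
    · have hu' : 3 / 2 < u.re := hu
      refine ⟨by linarith, ?_⟩
      have hne : u + 1 ≠ 1 := by
        intro h
        have := congrArg Complex.re h
        simp only [add_re, one_re] at this
        linarith
      have hζ : riemannZeta (u + 1) ≠ 0 :=
        riemannZeta_ne_zero_of_one_lt_re (by simp only [add_re, one_re]; linarith)
      intro h0
      have h := riemannZeta_eq_inv_sub_mul hne
      rw [h0, mul_zero] at h
      exact hζ h
    · refine ⟨hu.1, hfree (u + 1) ?_ ?_ ?_⟩
      · simp only [add_re, one_re]; linarith [hu.1]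
      · simp only [add_re, one_re]; linarith [hu.2.1]
      · simp only [add_im, one_im, add_zero]
        exact abs_lt.2 ⟨hu.2.2.1, hu.2.2.2⟩
  have hΦd : DifferentiableOn ℂ Φ ({s : ℂ | 3 / 2 < s.re} ∪ W₀) := by
    intro u hu
    obtain ⟨hre, hne⟩ := hmem u hu
    have d3 : DifferentiableAt ℂ H u :=
      (differentiableOn_mellinIoi_compensator u hre).differentiableAt
        ((isOpen_lt continuous_const Complex.continuous_re).mem_nhds hre)
    exact ((differentiableAt_continuation hre hne).add (d3.const_mul _)).differentiableWithinAt
  have hagree : EqOn Φ (Landau.mellinIoi g) {s : ℂ | 3 / 2 < s.re} := by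
    intro u hu
    have hu' : 3 / 2 < u.re := hu
    have hu1 : 1 < u.re := by linarith
    have hne := (hmem u (Or.inl hu)).2
    have h1 : Landau.mellinIoi liouvilleHarmonicSum u =
        riemannZeta (2 * u + 2) / riemannZeta₁ (u + 1) := by
      rw [eq_div_iff hne]
      exact mellinIoi_mul_riemannZeta₁ hu1
    have hsplit : ∀ x : ℝ, ((g x : ℝ) : ℂ) * (x : ℂ) ^ (-(u + 1)) =
        ((liouvilleHarmonicSum x : ℝ) : ℂ) * (x : ℂ) ^ (-(u + 1)) +
          ((2 * K' : ℝ) : ℂ) * (((k x : ℝ) : ℂ) * (x : ℂ) ^ (-(u + 1))) := by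
      intro x; simp only [hg]; push_cast; ring
    have hIT := integrable_ofReal_mul_cpow measurable_liouvilleHarmonicSum hTint hu'
    have hIk := integrable_ofReal_mul_cpow measurable_compensator
      (integrableOn_compensator (σ := 0) (by norm_num)) (u := u) (by linarith)
    have hmg : Landau.mellinIoi g u = Landau.mellinIoi liouvilleHarmonicSum u +
        ((2 * K' : ℝ) : ℂ) * H u := by
      simp only [Landau.mellinIoi, hH]
      simp_rw [hsplit]
      rw [integral_add hIT (hIk.const_mul _), integral_const_mul]
    rw [hmg, h1, hΦ]
    push_cast
    ring
  -- Landau's lemma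
  have hL := Landau.integrableOn_of_differentiableOn_union_convex hgm hint hX₁ hpos
    (by norm_num : (-1 / 2 : ℝ) < 3 / 2) hW₀o hW₀c hW₀r hΦd hagree hσ
  -- back to `T = g - 2K' k`
  have : (fun x ↦ liouvilleHarmonicSum x * x ^ (-(σ + 1))) = fun x ↦
      g x * x ^ (-(σ + 1)) -
        2 * K' * (x ^ (-(1 / 2 : ℝ)) * (1 + Real.log x) ^ 2 * x ^ (-(σ + 1))) := by
    funext x
    simp only [hg, hk]
    ring
  rw [this]
  exact hL.sub ((integrableOn_compensator hσ).const_mul _)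

/-! ### Continuation to `Re u > −1/2` and the Riemann hypothesis -/

/-- **Analytic continuation of the representation** (Turán/Ingham: "being regular along the stretch
`s > 1/2` of the real axis, is regular in the half-plane `σ > 1/2`"): if
`∫_1^∞ |T(x)| x^{-(σ+1)} dx < ∞` for every `σ > −1/2`, then
`(∫_1^∞ T(x) x^{-(u+1)} dx) · ζ₁(u+1) = ζ(2u+2)` on the whole half-plane `Re u > −1/2` (identity theorem
on the convex half-plane; both sides are holomorphic there). [cite: Turan1948, Thm. I (proof)] -/
theorem mellinIoi_mul_riemannZeta₁_eq_of_integrable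
    (hI : ∀ σ : ℝ, -1 / 2 < σ →
      IntegrableOn (fun x ↦ liouvilleHarmonicSum x * x ^ (-(σ + 1))) (Ioi 1))
    {u : ℂ} (hu : -1 / 2 < u.re) :
    Landau.mellinIoi liouvilleHarmonicSum u * riemannZeta₁ (u + 1) = riemannZeta (2 * u + 2) := by
  set V : Set ℂ := {z : ℂ | -1 / 2 < z.re} with hV
  have hVo : IsOpen V := isOpen_lt continuous_const Complex.continuous_re
  have hFd : DifferentiableOn ℂ (Landau.mellinIoi liouvilleHarmonicSum) V :=
    Landau.differentiableOn_mellinIoi_of_forall measurable_liouvilleHarmonicSum hI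
  set Ψ : ℂ → ℂ := fun z ↦ Landau.mellinIoi liouvilleHarmonicSum z * riemannZeta₁ (z + 1) -
    riemannZeta (2 * z + 2) with hΨ
  have hΨd : DifferentiableOn ℂ Ψ V := by
    intro z hz
    have hz' : -1 / 2 < z.re := hz
    have h2z : 2 * z + 2 ≠ 1 := by
      intro h
      have := congrArg Complex.re h
      simp at this
      linarith
    have d1 : DifferentiableAt ℂ (Landau.mellinIoi liouvilleHarmonicSum) z :=
      (hFd z hz).differentiableAt (hVo.mem_nhds hz)
    have d2 : DifferentiableAt ℂ (fun w : ℂ ↦ riemannZeta₁ (w + 1)) z :=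
      (differentiable_riemannZeta₁.comp (differentiable_id.add_const (1 : ℂ))).differentiableAt
    have d3 : DifferentiableAt ℂ (fun w : ℂ ↦ riemannZeta (2 * w + 2)) z :=
      (differentiableAt_riemannZeta h2z).comp z
        ((differentiableAt_id.const_mul _).add_const _)
    exact ((d1.mul d2).sub d3).differentiableWithinAt
  have hΨa : AnalyticOnNhd ℂ Ψ V := hΨd.analyticOnNhd hVo
  have hev : Ψ =ᶠ[𝓝 (2 : ℂ)] 0 := by
    filter_upwards [(isOpen_lt continuous_const Complex.continuous_re).mem_nhds
      (show (2 : ℂ) ∈ {z : ℂ | 1 < z.re} by simp)] with z hz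
    have hz1 : 1 < z.re := hz
    simp only [hΨ, Pi.zero_apply, mellinIoi_mul_riemannZeta₁ hz1, sub_self]
  have hzero := hΨa.eqOn_zero_of_preconnected_of_eventuallyEq_zero
    (convex_halfSpace_re_gt _).isPreconnected (show (2 : ℂ) ∈ V by simp [hV]; norm_num) hev
  have := hzero hu
  simp only [hΨ, Pi.zero_apply, sub_eq_zero] at this
  exact this

/-- Corollary: under the same hypothesis `ζ(ρ) ≠ 0` for `1/2 < Re ρ < 1` (else `u = ρ − 1` gives
`ζ(2ρ) = 0` with `Re 2ρ > 1`). [cite: Turan1948, Thm. I] -/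
theorem riemannZeta_ne_zero_of_integrable
    (hI : ∀ σ : ℝ, -1 / 2 < σ →
      IntegrableOn (fun x ↦ liouvilleHarmonicSum x * x ^ (-(σ + 1))) (Ioi 1))
    {ρ : ℂ} (h1 : 1 / 2 < ρ.re) (h2 : ρ.re < 1) : riemannZeta ρ ≠ 0 := by
  intro hρ
  have hu : -1 / 2 < (ρ - 1).re := by simp; linarith
  have h := mellinIoi_mul_riemannZeta₁_eq_of_integrable hI hu
  have hρ1 : ρ ≠ 1 := by
    rintro rfl
    norm_num at h2
  have hζ₁ : riemannZeta₁ ρ = 0 := by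
    have h' := riemannZeta_eq_inv_sub_mul hρ1
    rw [hρ] at h'
    exact (mul_eq_zero.1 h'.symm).resolve_left (inv_ne_zero (sub_ne_zero.2 hρ1))
  rw [sub_add_cancel, hζ₁, mul_zero, show 2 * (ρ - 1) + 2 = 2 * ρ by ring] at h
  exact riemannZeta_ne_zero_of_one_lt_re (s := 2 * ρ) (by simp; linarith) h.symm

end TuranLiouville

open TuranLiouville in
/-- **Turán's criterion through Liouville's function, sharp form** (Turán 1948, Thms. I–II as rendered
by Ingham; hypothesis in the `O(n^{-1/2})`-form of Mossinghoff–Trudgian 2012 §1, weakened by the factor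
`(1 + log n)²`): if for some `K` and `N₁` one has `T(n) = ∑_{m ≤ n} λ(m)/m ≥ −K(1 + log n)²/√n` for all
`n ≥ N₁`, then the Riemann hypothesis holds. [cite: Turan1948, Thms. I–II]
[cite: MossinghoffTrudgian2012, §1] -/
theorem riemannHypothesis_of_liouvilleHarmonicSum_lower_bound
    (h : ∃ K : ℝ, ∃ N₁ : ℕ, ∀ n : ℕ, N₁ ≤ n →
      -(K * (1 + Real.log n) ^ 2 / Real.sqrt n) ≤ liouvilleHarmonicSum n) :
    RiemannHypothesis := by
  obtain ⟨K, N₁, hb⟩ := h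
  have hI : ∀ σ : ℝ, -1 / 2 < σ →
      IntegrableOn (fun x ↦ liouvilleHarmonicSum x * x ^ (-(σ + 1))) (Ioi 1) :=
    fun σ hσ ↦ integrableOn_liouvilleHarmonicSum_rpow_of_lower_bound hb hσ
  have hQ : QuasiRiemannHypothesis (1 / 2) := fun ρ hρ h1 h2 ↦
    riemannZeta_ne_zero_of_integrable hI h1 h2 hρ
  exact (quasiRiemannHypothesis_one_half_iff_holds : QuasiRiemannHypothesis (1 / 2) ↔ _).1 hQ

end Literature.NumberTheory.LFunctions

end
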